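import Literature.Probability.Process.RootedHardCoreConfig
import Mathlib.MeasureTheory.Integral.Bochner.Basic
import Mathlib.MeasureTheory.Integral.Bochner.Set
import Mathlib.Topology.UniformSpace.HeineCantor
import HarnessLib

/-!
# Local functionals (vague continuity) and re-rooting on rooted hard-core configurations

Topic: `Literature/Probability/Process`. Sequel of `RootedHardCoreConfig.lean` (definition request
`defn-LocallyMatches`, part (2): "equivalently vague convergence of counting measures").

* `LocalConfig.continuous_integral_toMeasure` — for `δ > 0`, `E` proper and `f : E → ℝ` continuous
  with compact support, the LOCAL FUNCTIONAL `S ↦ ∫ f d(count|S) = ∑_{y ∈ S} f y` is CONTINUOUS on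
  the compact metric space `RootedHardCoreConfig E δ` of rooted `δ`-hard-core configurations with
  the local rubber metric. Equivalently: convergence in the local rubber topology implies vague
  convergence of the counting measures — the continuity direction of Baake–Lenz
  [BaakeLenz2004, §4 Thm 4] (`δ : 𝒟_V → ℳ` is a topological conjugacy onto its image), in the
  form consumed by weak limits of laws: `P ↦ ∫ (∫ f d count|S) dP(S)` is then weakly continuous,
  so energies `E_P[h_R]` of truncated (continuous, compactly supported) root functionals pass to
  Benjamini–Schramm limits. Proof (as `PeriodicConfiguration.tendsto_sum_of_eventually_near` in
  `MathematicalPhysics/StatisticalMechanics/CrystallizationLocalLimit.lean`): for a fine matching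
  both ways, separation makes the matching a bijection between the points of the two
  configurations near the support of `f`, and `f` is uniformly continuous.
* `LocalConfig.RootedHardCoreConfig.eq_of_forall_integral_eq`,
  `LocalConfig.RootedHardCoreConfig.tendsto_iff_forall_integral_tendsto` — local functionals
  SEPARATE rooted hard-core configurations, hence (compactness) a sequence converges in the local
  rubber metric IFF all local functionals converge: LOCAL CONVERGENCE = VAGUE CONVERGENCE of the
  counting measures (Baake–Lenz Thm 4, sequential form).
* `LocalConfig.RootedHardCoreConfig.reroot S y hy` — re-rooting at a point `y ∈ S` stays in the
  class; `toMeasure_reroot`: it is the shift `θ_y μ = μ.map (· - y)` of `IsPointStationaryLaw`.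
* `LocalConfig.integral_toMeasure_eq_finset_sum` — `∫ f d(count|S)` is the finite sum over the
  points of `S` in any compact set off which `f` vanishes (`count_restrict_finset_eq_sum_dirac`,
  `integral_count_restrict_finset`; cf. the same identities for finite configurations in
  `MathematicalPhysics/StatisticalMechanics/RootEnergy.lean`).

## References
* M. Baake, D. Lenz, Ergodic Theory Dynam. Systems 24 (2004), §4 Thm 4. [BaakeLenz2004]
-/

noncomputable section

open _root_.MeasureTheory Set Filter Metric TopologicalSpace
open scoped _root_.Topology ENNReal BigOperators

namespace Literature.Probability.Process

namespace LocalConfig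

/-! ### Integrals against counting measures of finite sets -/

section FinsetIntegral

variable {E : Type*} [MeasurableSpace E] [MeasurableSingletonClass E]

/-- The counting measure restricted to a finite set is the sum of the Dirac masses at its points,
`count|T = ∑_{y ∈ T} δ_y`. [folklore] -/
theorem count_restrict_finset_eq_sum_dirac (T : Finset E) :
    (Measure.count : Measure E).restrict (↑T : Set E) = ∑ y ∈ T, Measure.dirac y := by
  classical
  induction T using Finset.induction_on with
  | empty => simp
  | insert a T ha ih =>
    rw [Finset.coe_insert, Set.insert_eq,
      Measure.restrict_union (Set.disjoint_singleton_left.2 (by exact_mod_cast ha))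
        T.measurableSet,
      ih, Measure.restrict_singleton, Measure.count_singleton, one_smul, Finset.sum_insert ha]

/-- Integration against the counting measure of a finite set is the finite sum (no integrability
hypothesis). [folklore] -/
theorem integral_count_restrict_finset (T : Finset E) (f : E → ℝ) :
    ∫ y, f y ∂((Measure.count : Measure E).restrict (↑T : Set E)) = ∑ y ∈ T, f y := by
  rw [count_restrict_finset_eq_sum_dirac,
    integral_finsetSum_measure fun i _ => integrable_dirac (by simp)]
  simp

end FinsetIntegral

/-! ### Vague continuity of the counting-measure map -/

section Vague

variable {E : Type*} [NormedAddCommGroup E] [ProperSpace E] [MeasurableSpace E] [BorelSpace E]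
  {δ : ℝ}

/-- The integral of a function vanishing off a compact set `K'` against `count|S`, `S` a rooted
hard-core configuration, is the finite sum of its values over the points of `S` in `K'`.
[folklore] -/
theorem integral_toMeasure_eq_finset_sum (S : RootedHardCoreConfig E δ) {f : E → ℝ}
    {K' : Set E} (hK' : IsCompact K') (hf : ∀ x, x ∉ K' → f x = 0)
    (hfin : (K' ∩ ((S.1 : LocalConfig E) : Set E)).Finite) :
    ∫ y, f y ∂((S.1 : LocalConfig E).toMeasure) = ∑ y ∈ hfin.toFinset, f y := by
  rw [toMeasure_def, ← setIntegral_eq_integral_of_forall_compl_eq_zero (s := K')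
      (fun x hx => hf x hx), Measure.restrict_restrict hK'.isClosed.measurableSet,
    ← integral_count_restrict_finset, hfin.coe_toFinset]

/-- **Local functionals are continuous** (vague continuity of `S ↦ count|S` on rooted hard-core
configurations): for `δ > 0`, proper `E` and `f` continuous with compact support,
`S ↦ ∫ f d(count|S) = ∑_{y ∈ S} f y` is continuous for the local rubber metric. A fine two-way
matching is, by separation, a bijection between the points of the two configurations near the
support of `f`, along which `f` varies little (uniform continuity).
[cite: BaakeLenz2004, §4 Thm 4 (continuity of δ : 𝒟_V → ℳ for the vague topology)] -/
theorem continuous_integral_toMeasure (hδ : 0 < δ) {f : E → ℝ} (hfc : Continuous f)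
    (hf : HasCompactSupport f) :
    Continuous fun S : RootedHardCoreConfig E δ => ∫ y, f y ∂((S.1 : LocalConfig E).toMeasure) := by
  classical
  refine continuous_iff_continuousAt.2 fun S₀ => ?_
  rw [ContinuousAt, Metric.tendsto_nhds]
  intro η hη
  -- the support `K`, its half-fattening `K'` (domain of the matching) and unit fattening `K₁`
  set K : Set E := tsupport f with hK_def
  have hK : IsCompact K := hf
  have hK' : IsCompact (cthickening (1 / 2) K) := hK.cthickening
  have hK₁ : IsCompact (cthickening 1 K) := hK.cthickening
  have hfK : ∀ x, x ∉ K → f x = 0 := fun x hx => image_eq_zero_of_notMem_tsupport hx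
  have hfK' : ∀ x, x ∉ cthickening (1 / 2) K → f x = 0 := fun x hx =>
    hfK x fun h => hx (self_subset_cthickening K h)
  have hfK₁ : ∀ x, x ∉ cthickening 1 K → f x = 0 := fun x hx =>
    hfK x fun h => hx (self_subset_cthickening K h)
  -- the finitely many points of `S₀` in `K₁`
  have hF₀ : (cthickening 1 K ∩ ((S₀.1 : LocalConfig E) : Set E)).Finite :=
    finite_inter_of_separated hδ S₀.2.2 hK₁
  set n : ℕ := hF₀.toFinset.card with hn_def
  -- uniform continuity of `f` at scale `η / (n + 1)`
  obtain ⟨θ, hθ, hθf⟩ := Metric.uniformContinuous_iff.1 (hf.uniformContinuous_of_continuous hfc)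
    (η / (n + 1)) (by positivity)
  -- tolerance and radius of the matching
  set ε : ℝ := min (θ / 2) (min (δ / 3) (1 / 2)) with hε_def
  have hε : 0 < ε := lt_min (by positivity) (lt_min (by positivity) (by norm_num))
  have hεθ : ε < θ := by
    have := min_le_left (θ / 2) (min (δ / 3) (1 / 2))
    linarith
  have h2ε : 2 * ε < δ := by
    have := (min_le_right (θ / 2) (min (δ / 3) (1 / 2))).trans (min_le_left _ _)
    linarith
  have hε2 : ε ≤ 1 / 2 := (min_le_right _ _).trans (min_le_right _ _)
  obtain ⟨R, hR⟩ := hK₁.isBounded.subset_closedBall (0 : E)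
  have hK'K₁ : cthickening ε (cthickening (1 / 2) K) ⊆ cthickening 1 K :=
    (cthickening_cthickening_subset hε.le (by norm_num) K).trans
      (cthickening_mono (by linarith) K)
  have hKK' : cthickening ε K ⊆ cthickening (1 / 2) K := cthickening_mono hε2 K
  have hK'R : ∀ x ∈ cthickening (1 / 2) K, ‖x‖ ≤ R := fun x hx =>
    mem_closedBall_zero_iff.1 (hR (cthickening_mono (by norm_num) K hx))
  have hK₁R : ∀ x ∈ cthickening 1 K, ‖x‖ ≤ R := fun x hx => mem_closedBall_zero_iff.1 (hR hx)
  -- eventually, a two-way `(R, ε)`-matching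
  have hev : ∀ᶠ S : RootedHardCoreConfig E δ in 𝓝 S₀,
      LocallyMatches R ε ((S₀.1 : LocalConfig E) : Set E) ((S.1 : LocalConfig E) : Set E) :=
    (continuous_subtype_val.tendsto S₀).eventually
      ((nhds_hasBasis_locallyMatches S₀.1).mem_of_mem (i := (R, ε)) hε)
  filter_upwards [hev] with S hS
  -- the points of `S` in `K'` and their matches in `S₀`
  have hD : (cthickening (1 / 2) K ∩ ((S.1 : LocalConfig E) : Set E)).Finite :=
    finite_inter_of_separated hδ S.2.2 hK'
  have hq : ∀ p ∈ cthickening (1 / 2) K ∩ ((S.1 : LocalConfig E) : Set E),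
      ∃ q ∈ ((S₀.1 : LocalConfig E) : Set E), dist q p ≤ ε := fun p hp =>
    hS.1 p hp.2 (hK'R p hp.1)
  choose! q hq using hq
  have hqF₀ : ∀ p ∈ hD.toFinset, q p ∈ hF₀.toFinset := fun p hp => by
    rw [Finite.mem_toFinset] at hp ⊢
    exact ⟨hK'K₁ (mem_cthickening_of_dist_le (q p) p ε _ hp.1 (hq p hp).2), (hq p hp).1⟩
  have hqinj : Set.InjOn q ↑hD.toFinset := by
    intro p hp p' hp' hpp'
    rw [Finset.mem_coe, Finite.mem_toFinset] at hp hp'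
    by_contra hne
    have h1 := S.2.2 p hp.2 p' hp'.2 hne
    have : dist p p' ≤ 2 * ε :=
      calc dist p p' ≤ dist p (q p) + dist (q p) p' := dist_triangle _ _ _
        _ ≤ ε + ε := add_le_add (by rw [dist_comm]; exact (hq p hp).2)
            (by rw [hpp']; exact (hq p' hp').2)
        _ = 2 * ε := by ring
    linarith
  -- every point of `S₀` where `f ≠ 0` is matched
  have himage : ∀ q₀ ∈ hF₀.toFinset, q₀ ∉ hD.toFinset.image q → f q₀ = 0 := by
    intro q₀ hq₀ hq₀im
    by_contra hfq₀
    rw [Finite.mem_toFinset] at hq₀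
    have hq₀K : q₀ ∈ K := subset_tsupport f hfq₀
    obtain ⟨p', hp'S, hq₀p'⟩ := hS.2 q₀ hq₀.2 (hK₁R q₀ hq₀.1)
    have hp'D : p' ∈ hD.toFinset := by
      rw [Finite.mem_toFinset]
      exact ⟨hKK' (mem_cthickening_of_dist_le p' q₀ ε K hq₀K (by rw [dist_comm]; exact hq₀p')),
        hp'S⟩
    have hp'D' : p' ∈ cthickening (1 / 2) K ∩ ((S.1 : LocalConfig E) : Set E) := by
      rwa [Finite.mem_toFinset] at hp'D
    have hqq₀ : q p' = q₀ := by
      by_contra hne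
      have h1 := S₀.2.2 (q p') (hq p' hp'D').1 q₀ hq₀.2 hne
      have : dist (q p') q₀ ≤ 2 * ε :=
        calc dist (q p') q₀ ≤ dist (q p') p' + dist p' q₀ := dist_triangle _ _ _
          _ ≤ ε + ε := add_le_add (hq p' hp'D').2 (by rw [dist_comm]; exact hq₀p')
          _ = 2 * ε := by ring
      linarith
    exact hq₀im (Finset.mem_image.2 ⟨p', hp'D, hqq₀⟩)
  -- the two integrals as finite sums
  rw [integral_toMeasure_eq_finset_sum S hK' hfK' hD,
    integral_toMeasure_eq_finset_sum S₀ hK₁ hfK₁ hF₀, Real.dist_eq]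
  have hsum₀ : ∑ y ∈ hF₀.toFinset, f y = ∑ p ∈ hD.toFinset, f (q p) := by
    rw [← Finset.sum_image hqinj, ← Finset.sum_sdiff (Finset.image_subset_iff.2 hqF₀),
      Finset.sum_eq_zero fun x hx => himage x (Finset.mem_sdiff.1 hx).1 (Finset.mem_sdiff.1 hx).2,
      zero_add]
  rw [hsum₀, ← Finset.sum_sub_distrib]
  -- termwise estimate and counting
  have hcard : hD.toFinset.card ≤ n := Finset.card_le_card_of_injOn q hqF₀ hqinj
  have hterm : ∀ p ∈ hD.toFinset, |f p - f (q p)| ≤ η / (n + 1) := fun p hp => by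
    have hp' : p ∈ cthickening (1 / 2) K ∩ ((S.1 : LocalConfig E) : Set E) := by
      rwa [Finite.mem_toFinset] at hp
    have hd : dist p (q p) < θ := by
      rw [dist_comm]
      exact ((hq p hp').2).trans_lt hεθ
    have := hθf hd
    rw [Real.dist_eq] at this
    exact this.le
  calc |∑ p ∈ hD.toFinset, (f p - f (q p))|
      ≤ ∑ p ∈ hD.toFinset, |f p - f (q p)| := Finset.abs_sum_le_sum_abs _ _
    _ ≤ ∑ _p ∈ hD.toFinset, η / (n + 1) := Finset.sum_le_sum hterm
    _ = hD.toFinset.card * (η / (n + 1)) := by rw [Finset.sum_const, nsmul_eq_mul]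
    _ ≤ n * (η / (n + 1)) := by gcongr
    _ < η := by
        rw [mul_div_assoc', div_lt_iff₀ (by positivity)]
        nlinarith

/-- **Local functionals separate rooted hard-core configurations**: two rooted `δ`-hard-core
configurations (`δ > 0`) with the same integrals of all continuous compactly supported functions
are equal (a cone bump at a point of one missing the other, closed, configuration). [folklore] -/
theorem RootedHardCoreConfig.eq_of_forall_integral_eq (hδ : 0 < δ) {S T : RootedHardCoreConfig E δ}
    (h : ∀ f : E → ℝ, Continuous f → HasCompactSupport f →
      ∫ y, f y ∂((S.1 : LocalConfig E).toMeasure) = ∫ y, f y ∂((T.1 : LocalConfig E).toMeasure)) :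
    S = T := by
  suffices key : ∀ S T : RootedHardCoreConfig E δ, (∀ f : E → ℝ, Continuous f →
      HasCompactSupport f → ∫ y, f y ∂((S.1 : LocalConfig E).toMeasure) =
        ∫ y, f y ∂((T.1 : LocalConfig E).toMeasure)) →
      ((S.1 : LocalConfig E) : Set E) ⊆ ((T.1 : LocalConfig E) : Set E) by
    exact Subtype.ext (SetLike.coe_injective (Subset.antisymm (key S T h)
      (key T S fun f hf hfs => (h f hf hfs).symm)))
  intro S T h y hyS
  by_contra hyT
  -- a ball around `y` missing the closed set `T`
  obtain ⟨r₁, hr₁, hball⟩ :=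
    Metric.isOpen_iff.1 (RootedHardCoreConfig.isClosed_coe hδ T).isOpen_compl y hyT
  set r : ℝ := r₁ / 2 with hr_def
  have hr : 0 < r := by positivity
  -- the cone bump at `y` of radius `r`
  set f : E → ℝ := fun z => max 0 (r - dist z y) with hf_def
  have hfc : Continuous f :=
    continuous_const.max (continuous_const.sub (continuous_id.dist continuous_const))
  have hfK : ∀ z, z ∉ closedBall y r → f z = 0 := fun z hz => by
    rw [mem_closedBall] at hz
    exact max_eq_left (by linarith)
  have hfs : HasCompactSupport f := HasCompactSupport.intro (isCompact_closedBall y r) hfK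
  have hf0 : ∀ z, 0 ≤ f z := fun z => le_max_left _ _
  -- `∫ f dT = 0`
  have hT : ∫ z, f z ∂((T.1 : LocalConfig E).toMeasure) = 0 := by
    rw [integral_toMeasure_eq_finset_sum T (isCompact_closedBall y r) hfK
      (finite_inter_of_separated hδ T.2.2 (isCompact_closedBall y r))]
    refine Finset.sum_eq_zero fun z hz => ?_
    rw [Finite.mem_toFinset] at hz
    have hzT : z ∉ ball y r₁ := fun hzb => hball hzb hz.2
    rw [mem_ball] at hzT
    exact max_eq_left (by push Not at hzT; linarith)
  -- `∫ f dS ≥ f y = r > 0`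
  have hS : r ≤ ∫ z, f z ∂((S.1 : LocalConfig E).toMeasure) := by
    have hfin := finite_inter_of_separated hδ S.2.2 (isCompact_closedBall y r)
    rw [integral_toMeasure_eq_finset_sum S (isCompact_closedBall y r) hfK hfin]
    have hy : y ∈ hfin.toFinset := by
      rw [Finite.mem_toFinset]
      exact ⟨mem_closedBall_self hr.le, hyS⟩
    have hfy : f y = r := by simp [hf_def, hr.le]
    calc r = f y := hfy.symm
      _ ≤ ∑ z ∈ hfin.toFinset, f z := Finset.single_le_sum (fun z _ => hf0 z) hy
  have := h f hfc hfs
  linarith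

/-- **Local convergence is vague convergence** on rooted hard-core configurations (Baake–Lenz
Thm 4, sequential form): for `δ > 0` and proper `E`, a sequence of rooted `δ`-hard-core
configurations converges in the local rubber metric iff the integrals of every continuous
compactly supported function against the counting measures converge. (`⇒`:
`continuous_integral_toMeasure`; `⇐`: compactness, continuity and separation by local
functionals.) [cite: BaakeLenz2004, §4 Thm 4] -/
theorem RootedHardCoreConfig.tendsto_iff_forall_integral_tendsto (hδ : 0 < δ)
    {u : ℕ → RootedHardCoreConfig E δ} {S : RootedHardCoreConfig E δ} :
    Tendsto u atTop (𝓝 S) ↔ ∀ f : E → ℝ, Continuous f → HasCompactSupport f →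
      Tendsto (fun n => ∫ y, f y ∂(((u n).1 : LocalConfig E).toMeasure)) atTop
        (𝓝 (∫ y, f y ∂((S.1 : LocalConfig E).toMeasure))) := by
  constructor
  · intro hu f hf hfs
    exact ((continuous_integral_toMeasure hδ hf hfs).tendsto S).comp hu
  · intro h
    haveI : Fact (0 < δ) := ⟨hδ⟩
    refine tendsto_of_subseq_tendsto fun ns hns => ?_
    obtain ⟨S', ms, hms, hS'⟩ := CompactSpace.tendsto_subseq (u ∘ ns)
    have hSS' : S' = S := by
      refine RootedHardCoreConfig.eq_of_forall_integral_eq hδ fun f hf hfs => ?_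
      have h1 : Tendsto (fun n => ∫ y, f y ∂(((u (ns (ms n))).1 : LocalConfig E).toMeasure))
          atTop (𝓝 (∫ y, f y ∂((S'.1 : LocalConfig E).toMeasure))) :=
        ((continuous_integral_toMeasure hδ hf hfs).tendsto S').comp hS'
      have h2 : Tendsto (fun n => ∫ y, f y ∂(((u (ns (ms n))).1 : LocalConfig E).toMeasure))
          atTop (𝓝 (∫ y, f y ∂((S.1 : LocalConfig E).toMeasure))) :=
        (h f hf hfs).comp (hns.comp hms.tendsto_atTop)
      exact tendsto_nhds_unique h1 h2
    exact ⟨ms, by rw [← hSS']; exact hS'⟩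

end Vague

/-! ### Re-rooting at a point -/

section Reroot

variable {E : Type*} [NormedAddCommGroup E] {δ : ℝ}

/-- **Re-rooting** a rooted `δ`-hard-core configuration at one of its points `y ∈ S`: the
configuration `S - y` seen from `y`, again rooted (`y - y = 0`) and `δ`-separated. This is the
deterministic half of the "root ⇝ typical point" transfer under a point-stationary law
(`IsRootedHardCore.map_sub`). [folklore] -/
def RootedHardCoreConfig.reroot (S : RootedHardCoreConfig E δ) (y : E)
    (hy : y ∈ ((S.1 : LocalConfig E) : Set E)) : RootedHardCoreConfig E δ :=
  ⟨(S.1 : LocalConfig E).translate y, zero_mem_translate hy, separated_translate S.2.2 y⟩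

/-- The carrier of the re-rooted configuration is the translated point set. [folklore] -/
@[simp] theorem RootedHardCoreConfig.coe_reroot (S : RootedHardCoreConfig E δ) (y : E)
    (hy : y ∈ ((S.1 : LocalConfig E) : Set E)) :
    (((S.reroot y hy).1 : LocalConfig E) : Set E) =
      (fun z => z - y) '' ((S.1 : LocalConfig E) : Set E) :=
  rfl

/-- **Re-rooting is the shift `θ_y` of `IsPointStationaryLaw`** on counting measures:
`count|(S - y) = (count|S).map (· - y)`. [folklore] -/
theorem RootedHardCoreConfig.toMeasure_reroot [MeasurableSpace E] [MeasurableSingletonClass E]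
    [MeasurableAdd E] (S : RootedHardCoreConfig E δ) (y : E)
    (hy : y ∈ ((S.1 : LocalConfig E) : Set E)) :
    ((S.reroot y hy).1 : LocalConfig E).toMeasure =
      ((S.1 : LocalConfig E).toMeasure).map (fun z => z - y) :=
  toMeasure_translate _ _

end Reroot

end LocalConfig

end Literature.Probability.Process
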